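import Mathlib
import Literature.NumberTheory.Automorphic.HilbertModularFormQExpansion
import Summits.Langlands.Langlands.Theorems.CapacityClassicalityHilbertIntegralOverconvergentIsCongruenceKoecherGlue
import Summits.Langlands.Langlands.Theorems.CapacityClassicalityHilbertIntegralOverconvergentIsCongruenceStubIndicatorModularForm

/-!
# The constant function `1` lies in the cone class (stub S3)

Stub S3 `stub_coneClass_one` of line Sketch-ideate-r1-k1 (section S, relations between encoded
`q`-expansions → relations between functions) for the crux `HilbertIntegralOverconvergentIsCongruence`
(stmt-Langlands-8485).  The CONE CLASS consists of the functions on the ambient space `ℂ^{Hom(F,ℝ)}`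
that are holomorphic on `ℍ`, `𝓞 F`-periodic on `ℍ`, and whose Fourier coefficients on the dual
lattice are supported on the cone `qIndexSet F`.  We put the constant function `1 : Point F → ℂ` in it
and compute its Fourier coefficients on the dual lattice: `a_0 = 1` and `a_μ = 0` for `μ ≠ 0`.
Holomorphy is `differentiableOn_const`, periodicity is `rfl`; the Fourier coefficient
`a_μ(h) = ∫_{[0,1]^ι} h(x + i) e^{-2πi S(μ(x+i))} dx` only sees the values of `h` at the cube points
`x + i ∈ ℍ` (`koe_cubePoint_mem_halfSpace`), where `1` agrees with the unit form `1_ℍ` (the indicator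
of `ℍ`), so `a_μ(1) = a_μ(1_ℍ)` and the landed `ind_fourierCoeff_zero`, `ind_fourierCoeff_of_ne_zero`
(the coefficients of `stub_indicator_modularForm`) give the two values.
-/

set_option linter.dupNamespace false

noncomputable section

namespace Summit.Langlands.Langlands.Theorems.HilbertIntegralOverconvergentIsCongruence

open MeasureTheory Complex NumberField
open Literature.NumberTheory.Automorphic Literature.NumberTheory.Automorphic.HilbertModular

/-- The Fourier coefficients of the constant `1` are those of the unit form `1_ℍ`: the defining cube
integral only evaluates the function at points of `ℍ`, where the two agree. -/
theorem cco_fourierCoeff_one_eq (F : Type) [Field F] [NumberField F] (μ : F) :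
    fourierCoeff (1 : Point F → ℂ) μ = fourierCoeff ((halfSpace F).indicator (fun _ ↦ (1 : ℂ))) μ := by
  unfold HilbertModular.fourierCoeff HilbertModular.fourierCoeffAt
  refine setIntegral_congr_fun measurableSet_Icc fun x _ ↦ ?_
  rw [Pi.one_apply, ind_indicator_of_mem (koe_cubePoint_mem_halfSpace x fun _ ↦ one_pos)]

/-- **Stub S3 — `stub_coneClass_one`.** The constant function `1` belongs to the cone class
(holomorphic on `ℍ`, `𝓞 F`-periodic on `ℍ`) and its Fourier coefficients on the dual lattice are
`[μ = 0]`: it agrees on `ℍ` with the unit form `1_ℍ` of the landed `stub_indicator_modularForm`, and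
Fourier coefficients only see values on `ℍ` (`cco_fourierCoeff_one_eq`). [folklore] -/
theorem stub_coneClass_one (F : Type) [Field F] [NumberField F] [NumberField.IsTotallyReal F] :
    IsHolomorphicOn F (1 : Point F → ℂ) ∧
      (∀ (a : 𝓞 F) (z : Point F), z ∈ halfSpace F →
        (1 : Point F → ℂ) (fun σ ↦ z σ + ((σ (a : F) : ℝ) : ℂ)) = (1 : Point F → ℂ) z) ∧
      fourierCoeff (1 : Point F → ℂ) 0 = 1 ∧
      ∀ μ : F, (∀ a : 𝓞 F, ∃ n : ℤ, Algebra.trace ℚ F (μ * a) = n) → μ ≠ 0 →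
        fourierCoeff (1 : Point F → ℂ) μ = 0 := by
  refine ⟨differentiableOn_const (1 : ℂ), fun _ _ _ ↦ rfl, ?_, fun μ hμ hμ0 ↦ ?_⟩
  · rw [cco_fourierCoeff_one_eq, ind_fourierCoeff_zero]
  · rw [cco_fourierCoeff_one_eq, ind_fourierCoeff_of_ne_zero F μ hμ hμ0]

end Summit.Langlands.Langlands.Theorems.HilbertIntegralOverconvergentIsCongruence

end
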